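import Literature.Geometry.Symplectic.PALFCollarProduct
import Mathlib.Analysis.InnerProductSpace.Calculus
import Mathlib.Analysis.Calculus.BumpFunction.InnerProduct
import HarnessLib

/-!
# Kas' Morse function on a Lefschetz fibration over the disc: the inward Lyapunov field

Topic `Literature/Geometry/Symplectic` (fact seat
`provefact-Literature.Geometry.Symplectic.Oba2016_s-add47373d4`; Kas 1980 §2, Gompf–Stipsicz 1999
§8.2: the handle decomposition of the total space of a Lefschetz fibration over `D²` from the
Morse function `A ∘ f + ε B`).  In the tree's currency a handle decomposition is a
boundary-adapted Morse function (`Literature.Topology.FourManifolds.HasHandleDecomposition`), produced from interior Morse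
data and an inward Lyapunov field by `Literature.Topology.FourManifolds.hasHandleDecomposition_of_interior`.  This file
builds the **field**.  Everything is proved; no definitions, no named facts.

For a PALF `P` on the compact `W` and a flow-out input `D` (`σ = D.f`, `N = D.ξ`, `dσ(N) = 1`
on `{σ ≤ D.δ}`):

* §1 `halfSpaceCoord_pos_of_mlineDeriv_pos`, `halfSpaceCoord_flowout_ξ_pos` — `N` is
  strictly inward; `mlineDeriv_nearForm` — the derivative of the near-boundary form
  `G₀ = ‖f - c₀‖² + ε bb ∘ σ` along a vector: `2⟪f x - c₀, df v⟫ + ε bb'(σ x) dσ(v)`;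
* §2 `exists_vertical_bound` — **the vertical boundary pushes `f` inwards**: there are `r₄ < 1`
  and `ρ₀ > 0` with `⟪f x - c₀, df(N x)⟫ < 0` whenever `‖f x‖ ≥ r₄` and `‖c₀‖ ≤ ρ₀`
  (`PALF.inner_mfderiv_neg_of_norm_eq_one` on the compact vertical boundary, continuity);
* §3 `exists_kasField` — **the Lyapunov field** `Z = N + M β₃(f) ν` (`ν` the kernel field of
  `PALF.exists_kernel_field_inward`, `β₃` a bump of the base): smooth, strictly inward on `∂W`, and
  `dG(Z) < 0` on `{σ < κ}` for every `G` of the near-boundary form there, when `bb' < 0` on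
  `[0, κ]` and `κ` is below the levels `D.δ`, `s₁` (`dσ(ν) > 0`).

## References

* A. Kas, *On the handlebody decomposition associated to a Lefschetz fibration*, Pacific J.
  Math. 89 (1980), §2. [Kas1980]
* R. E. Gompf, A. I. Stipsicz, *4-Manifolds and Kirby Calculus*, GSM 20 (1999), §8.2.
  [GompfStipsiczGSM1999]
-/

open scoped Manifold ContDiff Topology RealInnerProductSpace
open Set Function Filter

noncomputable section

namespace Literature.Geometry.Symplectic

open Literature.Topology.FourManifolds

universe u

variable {W : Type u} [TopologicalSpace W] [ChartedSpace (EuclideanHalfSpace 4) W]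
  [IsManifold (𝓡∂ 4) ∞ W]

/-! ### §1 Inwardness and the near-boundary form -/

/-- **Converse inwardness criterion**: at a boundary point where `σ` (`= 0` on `∂W`, `≥ 0`
everywhere) has positive derivative along `v`, the vector `v` is strictly inward — a tangent
vector would kill `dσ` (`Literature.Topology.FourManifolds.mlineDeriv_eq_zero_of_tangent_of_forall_boundary`) and a
strictly outward one would give `dσ(-v) > 0` (`mlineDeriv_pos_of_inward_of_forall_le'`).
[folklore] -/
theorem halfSpaceCoord_pos_of_mlineDeriv_pos {n : ℕ} {M : Type u} [TopologicalSpace M]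
    [ChartedSpace (EuclideanHalfSpace (n + 1)) M] [IsManifold (𝓡∂ (n + 1)) ∞ M]
    {σ : M → ℝ} {z : M} (hσ : MDifferentiableAt (𝓡∂ (n + 1)) 𝓘(ℝ, ℝ) σ z)
    (hσb : ∀ y ∈ (𝓡∂ (n + 1)).boundary M, σ y = 0) (hσ0 : ∀ y, 0 ≤ σ y)
    (hz : z ∈ (𝓡∂ (n + 1)).boundary M) {v : EuclideanSpace ℝ (Fin (n + 1))}
    (hv : 0 < mlineDeriv (𝓡∂ (n + 1)) σ z v) : 0 < v 0 := by
  by_contra h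
  rcases (not_lt.1 h).lt_or_eq with hneg | hzero
  · -- strictly outward: `-v` is strictly inward
    have hle : ∀ y, σ z ≤ σ y := fun y => by rw [hσb z hz]; exact hσ0 y
    have hncrit : ¬ IsMCriticalPt (𝓡∂ (n + 1)) σ z := by
      intro hc
      unfold IsMCriticalPt at hc
      rw [mlineDeriv_def, hc] at hv
      exact lt_irrefl _ hv
    have hw : 0 < halfSpaceCoord n (-v : EuclideanSpace ℝ (Fin (n + 1))) := by
      rw [halfSpaceCoord_apply, PiLp.neg_apply]; linarith
    have h1 := mlineDeriv_pos_of_inward_of_forall_le' hσ hle hz hncrit hw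
    have h2 : mlineDeriv (𝓡∂ (n + 1)) σ z (-v : EuclideanSpace ℝ (Fin (n + 1))) =
        -mlineDeriv (𝓡∂ (n + 1)) σ z v := by
      simp only [mlineDeriv_def]
      exact (mfderiv (𝓡∂ (n + 1)) 𝓘(ℝ, ℝ) σ z).map_neg v
    rw [h2] at h1
    linarith
  · -- tangent: `dσ v = 0`
    have h1 := mlineDeriv_eq_zero_of_tangent_of_forall_boundary hσb hσ hz hzero
    rw [h1] at hv
    exact lt_irrefl _ hv

/-- **The field of a flow-out input is strictly inward at the boundary** (`dσ(N) = 1 > 0`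
there). [folklore] -/
theorem halfSpaceCoord_flowout_ξ_pos {n : ℕ} {M : Type u} [TopologicalSpace M]
    [ChartedSpace (EuclideanHalfSpace (n + 1)) M] [IsManifold (𝓡∂ (n + 1)) ∞ M]
    (D : FlowoutInput n M) {z : M} (hz : z ∈ (𝓡∂ (n + 1)).boundary M) :
    0 < halfSpaceCoord n (D.ξ z) := by
  have h1 : mlineDeriv (𝓡∂ (n + 1)) D.f z (D.ξ z) = 1 :=
    D.mlineDeriv_f_ξ z (by rw [(D.f_eq_zero_iff z).2 hz]; exact D.δ_pos.le)
  rw [halfSpaceCoord_apply]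
  exact halfSpaceCoord_pos_of_mlineDeriv_pos ((D.f_smooth z).mdifferentiableAt (by simp))
    (fun y hy => (D.f_eq_zero_iff y).2 hy) D.f_nonneg hz (by rw [h1]; exact one_pos)

variable {o : SmoothOrientation (𝓡∂ 4) W} {b : BoundaryData (𝓡∂ 4) W (𝓡 3)} (P : PALF o b)

namespace PALF

/-- The differential of `y ↦ ⟪a, f y⟫` along `v` is `⟪a, df v⟫` (`mlineDeriv` form of
`PALF.hasMFDerivAt_inner_comp`). [folklore] -/
theorem mlineDeriv_inner_comp (a : EuclideanSpace ℝ (Fin 2)) (x : W) (v : EuclideanSpace ℝ (Fin 4)) :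
    mlineDeriv (𝓡∂ 4) (fun y => innerSL ℝ a (P.f y)) x v =
      ⟪a, mfderiv (𝓡∂ 4) 𝓘(ℝ, EuclideanSpace ℝ (Fin 2)) P.f x v⟫ := by
  rw [mlineDeriv_def, (P.hasMFDerivAt_inner_comp a x).mfderiv]
  rfl

/-- `x ↦ ⟪a, df_x(ξ x)⟫` is continuous for a smooth field `ξ`. [folklore] -/
theorem continuous_inner_mfderiv_section (a : EuclideanSpace ℝ (Fin 2))
    {ξ : Π x : W, TangentSpace (𝓡∂ 4) x}
    (hξ : ContMDiff (𝓡∂ 4) (𝓡∂ 4).tangent ∞ (fun x => (⟨x, ξ x⟩ : TangentBundle (𝓡∂ 4) W))) :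
    Continuous fun x => ⟪a, mfderiv (𝓡∂ 4) 𝓘(ℝ, EuclideanSpace ℝ (Fin 2)) P.f x (ξ x)⟫ := by
  have h := (contMDiff_mlineDeriv_section (f := fun y => innerSL ℝ a (P.f y))
    ((innerSL ℝ a).contDiff.comp_contMDiff P.contMDiff) hξ).continuous
  refine h.congr fun x => ?_
  exact P.mlineDeriv_inner_comp a x (ξ x)

/-- `x ↦ df_x(ξ x) ∈ ℝ²` is continuous for a smooth field `ξ` (coordinatewise, through
`continuous_inner_mfderiv_section`). [folklore] -/
theorem continuous_mfderiv_section {ξ : Π x : W, TangentSpace (𝓡∂ 4) x}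
    (hξ : ContMDiff (𝓡∂ 4) (𝓡∂ 4).tangent ∞ (fun x => (⟨x, ξ x⟩ : TangentBundle (𝓡∂ 4) W))) :
    Continuous fun x => mfderiv (𝓡∂ 4) 𝓘(ℝ, EuclideanSpace ℝ (Fin 2)) P.f x (ξ x) := by
  have hcoord : ∀ i : Fin 2, Continuous fun x =>
      WithLp.ofLp (mfderiv (𝓡∂ 4) 𝓘(ℝ, EuclideanSpace ℝ (Fin 2)) P.f x (ξ x)) i := by
    intro i
    have h := P.continuous_inner_mfderiv_section (EuclideanSpace.single i (1 : ℝ)) hξ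
    refine h.congr fun x => ?_
    simp [EuclideanSpace.inner_single_left]
  refine ((PiLp.continuous_toLp 2 (fun _ : Fin 2 => ℝ)).comp (continuous_pi hcoord)).congr fun x => ?_
  rfl

/-- **The near-boundary form and its derivative**: for `G₀ y = ‖f y - c₀‖² + ε bb (σ y)`,
`dG₀_x(v) = 2⟪f x - c₀, df v⟫ + ε bb'(σ x) dσ(v)`. [cite: Kas1980, §2] -/
theorem mlineDeriv_nearForm {σ : W → ℝ} (hσ : ContMDiff (𝓡∂ 4) 𝓘(ℝ, ℝ) ∞ σ) {bb : ℝ → ℝ}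
    (hbb : ContDiff ℝ ∞ bb) (c₀ : EuclideanSpace ℝ (Fin 2)) (ε : ℝ) (x : W) (v : EuclideanSpace ℝ (Fin 4)) :
    mlineDeriv (𝓡∂ 4) (fun y => ‖P.f y - c₀‖ ^ 2 + ε * bb (σ y)) x v =
      2 * ⟪P.f x - c₀, mfderiv (𝓡∂ 4) 𝓘(ℝ, EuclideanSpace ℝ (Fin 2)) P.f x v⟫ +
        ε * (deriv bb (σ x) * mlineDeriv (𝓡∂ 4) σ x v) := by
  have hf : HasMFDerivAt (𝓡∂ 4) 𝓘(ℝ, EuclideanSpace ℝ (Fin 2)) P.f x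
      (mfderiv (𝓡∂ 4) 𝓘(ℝ, EuclideanSpace ℝ (Fin 2)) P.f x) :=
    (P.contMDiff.mdifferentiableAt (by simp)).hasMFDerivAt
  have hA₀ : HasFDerivAt (fun u : EuclideanSpace ℝ (Fin 2) => ‖u - c₀‖ ^ 2)
      (2 • (innerSL ℝ (P.f x - c₀)).comp (ContinuousLinearMap.id ℝ _)) (P.f x) :=
    ((hasFDerivAt_id (P.f x)).sub_const c₀).norm_sq
  have hA : HasFDerivAt (fun u : EuclideanSpace ℝ (Fin 2) => ‖u - c₀‖ ^ 2)
      ((2 : ℝ) • innerSL ℝ (P.f x - c₀)) (P.f x) := by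
    refine hA₀.congr_fderiv ?_
    ext w
    simp [two_smul]
  have h1 : HasMFDerivAt (𝓡∂ 4) 𝓘(ℝ, ℝ) (fun y => ‖P.f y - c₀‖ ^ 2) x
      (((2 : ℝ) • innerSL ℝ (P.f x - c₀)).comp
        (mfderiv (𝓡∂ 4) 𝓘(ℝ, EuclideanSpace ℝ (Fin 2)) P.f x)) :=
    hA.hasMFDerivAt.comp x hf
  have hσx : HasMFDerivAt (𝓡∂ 4) 𝓘(ℝ, ℝ) σ x (mfderiv (𝓡∂ 4) 𝓘(ℝ, ℝ) σ x) :=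
    (hσ.mdifferentiableAt (by simp)).hasMFDerivAt
  have hb : HasDerivAt bb (deriv bb (σ x)) (σ x) :=
    (hbb.differentiable (by simp)).differentiableAt.hasDerivAt
  have h2 : HasMFDerivAt (𝓡∂ 4) 𝓘(ℝ, ℝ) (fun y => bb (σ y)) x
      ((ContinuousLinearMap.smulRight (1 : ℝ →L[ℝ] ℝ) (deriv bb (σ x))).comp
        (mfderiv (𝓡∂ 4) 𝓘(ℝ, ℝ) σ x)) :=
    hb.hasFDerivAt.hasMFDerivAt.comp x hσx
  have h3 := h1.add (h2.const_smul ε)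
  have h4 : (fun y => ‖P.f y - c₀‖ ^ 2 + ε * bb (σ y)) =
      (fun y => ‖P.f y - c₀‖ ^ 2) + ε • fun y => bb (σ y) := by
    funext y; simp [smul_eq_mul]
  rw [mlineDeriv_def, h4, h3.mfderiv]
  show (2 : ℝ) • ⟪P.f x - c₀, mfderiv (𝓡∂ 4) 𝓘(ℝ, EuclideanSpace ℝ (Fin 2)) P.f x v⟫ +
      ε • (((1 : ℝ →L[ℝ] ℝ) (mfderiv (𝓡∂ 4) 𝓘(ℝ, ℝ) σ x v)) • deriv bb (σ x)) = _
  rw [one_apply_eq_self, smul_eq_mul, smul_eq_mul, smul_eq_mul, mlineDeriv_def]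
  ring

/-! ### §2 The vertical boundary pushes `f` inwards -/

variable [CompactSpace W]

/-- **The vertical estimate.**  For a flow-out input `D` (`N = D.ξ` strictly inward at `∂W`)
there are `r₄ ∈ [0, 1)` and `ρ₀ > 0` such that `⟪f x - c₀, df(N x)⟫ < 0` whenever
`‖f x‖ ≥ r₄` and `‖c₀‖ ≤ ρ₀`: on the compact vertical boundary `{‖f‖ = 1}` one has
`⟪f, df N⟫ < 0` (`PALF.inner_mfderiv_neg_of_norm_eq_one`), hence `≤ -η`; this persists on an open
neighbourhood, which contains `{‖f‖ ≥ r₄}` by compactness; `⟪c₀, df N⟫` is small for `‖c₀‖`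
small. [cite: Kas1980, §2] -/
theorem exists_vertical_bound (D : FlowoutInput 3 W) :
    ∃ r₄ : ℝ, 0 ≤ r₄ ∧ r₄ < 1 ∧ ∃ ρ₀ : ℝ, 0 < ρ₀ ∧ ∀ x, r₄ ≤ ‖P.f x‖ →
      ∀ c₀ : EuclideanSpace ℝ (Fin 2), ‖c₀‖ ≤ ρ₀ →
        ⟪P.f x - c₀, mfderiv (𝓡∂ 4) 𝓘(ℝ, EuclideanSpace ℝ (Fin 2)) P.f x (D.ξ x)⟫ < 0 := by
  set dfN : W → EuclideanSpace ℝ (Fin 2) := fun x =>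
    mfderiv (𝓡∂ 4) 𝓘(ℝ, EuclideanSpace ℝ (Fin 2)) P.f x (D.ξ x) with hdfN
  have hdfNc : Continuous dfN := P.continuous_mfderiv_section D.ξ_smooth
  set g : W → ℝ := fun x => ⟪P.f x, dfN x⟫ with hg
  have hgc : Continuous g := Continuous.inner P.contMDiff.continuous hdfNc
  -- `g < 0` on the vertical boundary, hence `≤ -η`
  set V₁ : Set W := {x | ‖P.f x‖ = 1} with hV₁
  have hV₁c : IsCompact V₁ := (isClosed_eq (continuous_norm.comp P.contMDiff.continuous) continuous_const).isCompact
  have hgneg : ∀ x ∈ V₁, g x < 0 := by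
    intro x hx
    have hxb := P.mem_boundary_of_norm_eq_one hx
    have h := P.inner_mfderiv_neg_of_norm_eq_one hx (v := D.ξ x) (halfSpaceCoord_flowout_ξ_pos D hxb)
    rwa [innerSL_apply_apply] at h
  obtain ⟨η, hη, hgη⟩ : ∃ η : ℝ, 0 < η ∧ ∀ x ∈ V₁, g x ≤ -η := by
    by_cases hne : V₁.Nonempty
    · obtain ⟨x₀, hx₀, hmax⟩ := hV₁c.exists_isMaxOn hne hgc.continuousOn
      exact ⟨-g x₀, by linarith [hgneg x₀ hx₀], fun x hx => by
        have h := isMaxOn_iff.1 hmax x hx; linarith⟩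
    · exact ⟨1, one_pos, fun x hx => absurd ⟨x, hx⟩ hne⟩
  -- the open set `U = {g < -η/2}` contains `{‖f‖ ≥ r₄}` for some `r₄ < 1`
  set U : Set W := {x | g x < -η / 2} with hU
  have hUo : IsOpen U := isOpen_lt hgc continuous_const
  have hV₁U : V₁ ⊆ U := fun x hx => by
    simp only [hU, mem_setOf_eq]; linarith [hgη x hx]
  obtain ⟨r₄, hr₄0, hr₄1, hr₄U⟩ : ∃ r₄ : ℝ, 0 ≤ r₄ ∧ r₄ < 1 ∧ ∀ x, r₄ ≤ ‖P.f x‖ → x ∈ U := by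
    have hUcc : IsCompact Uᶜ := hUo.isClosed_compl.isCompact
    by_cases hne : (Uᶜ : Set W).Nonempty
    · obtain ⟨x₀, hx₀, hmax⟩ := hUcc.exists_isMaxOn hne (continuous_norm.comp P.contMDiff.continuous).continuousOn
      have hlt : ‖P.f x₀‖ < 1 := lt_of_le_of_ne (P.norm_apply_le_one x₀) fun h => hx₀ (hV₁U h)
      refine ⟨max 0 ((‖P.f x₀‖ + 1) / 2), le_max_left _ _, max_lt one_pos (by linarith), fun x hx => ?_⟩
      by_contra hxU
      have h1 : ‖P.f x‖ ≤ ‖P.f x₀‖ := isMaxOn_iff.1 hmax x hxU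
      have h2 := (le_max_right _ _).trans hx
      linarith
    · exact ⟨0, le_rfl, one_pos, fun x _ => by
        by_contra h; exact hne ⟨x, h⟩⟩
  -- the bound on `⟪c₀, df N⟫`
  obtain ⟨C, hC0, hC⟩ : ∃ C : ℝ, 0 ≤ C ∧ ∀ x, ‖dfN x‖ ≤ C := by
    obtain ⟨C, hC⟩ := isCompact_univ.exists_bound_of_continuousOn (continuous_norm.comp hdfNc).continuousOn
    exact ⟨max C 0, le_max_right _ _, fun x => (by simpa using hC x (mem_univ x) : ‖dfN x‖ ≤ C).trans
      (le_max_left _ _)⟩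
  set ρ₀ : ℝ := η / (2 * (2 * C + 1)) with hρ₀
  have hρ₀pos : 0 < ρ₀ := by positivity
  refine ⟨r₄, hr₄0, hr₄1, ρ₀, hρ₀pos, fun x hx c₀ hc₀ => ?_⟩
  have hxU : g x < -η / 2 := hr₄U x hx
  have h1 : ⟪P.f x - c₀, dfN x⟫ = g x - ⟪c₀, dfN x⟫ := by
    rw [hg, inner_sub_left]
  have h2 : |⟪c₀, dfN x⟫| ≤ ρ₀ * C :=
    (abs_real_inner_le_norm _ _).trans (mul_le_mul hc₀ (hC x) (norm_nonneg _) hρ₀pos.le)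
  have h3 : ρ₀ * C < η / 2 := by
    rw [hρ₀]
    have : η / (2 * (2 * C + 1)) * C = η / 2 * (C / (2 * C + 1)) := by
      field_simp
    rw [this]
    have h4 : C / (2 * C + 1) < 1 := by
      rw [div_lt_one (by positivity)]; linarith
    calc η / 2 * (C / (2 * C + 1)) < η / 2 * 1 := by
          exact mul_lt_mul_of_pos_left h4 (by positivity)
      _ = η / 2 := mul_one _
  show ⟪P.f x - c₀, dfN x⟫ < 0
  rw [h1]
  have h5 := neg_abs_le ⟪c₀, dfN x⟫
  linarith [abs_nonneg ⟪c₀, dfN x⟫]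

/-! ### §3 The Lyapunov field -/

/-- **Kas' inward Lyapunov field.**  Let `D` be a flow-out input, `c₀ ∈ ℝ²`, radii
`0 ≤ r₄ < r₄' ≤ r` with the vertical estimate `⟪f x - c₀, df(N x)⟫ < 0` on `{‖f‖ ≥ r₄}`
(`exists_vertical_bound`), `ν` a smooth field, weakly inward on `∂W`, in `ker df` over
`{‖f‖ ≤ r}`, with `dσ(ν) > 0` on `{‖f‖ ≤ r, σ < s₁}` (`PALF.exists_kernel_field_inward`,
`PALF.exists_pos_forall_mlineDeriv_pos`); let `κ < c`, `κ < s₁`, `κ ≤ D.δ`, `ε > 0`, `bb` smooth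
with `bb' < 0` on `[0, κ]`, and `G : W → ℝ` of the near-boundary form `‖f - c₀‖² + ε bb ∘ σ` near
every point of `{σ < c}`.  Then `Z = N + M β₃(f) ν`, for a bump `β₃` of the base equal to `1` on
the `r₄`-disc and supported in the `r₄'`-disc and `M` large, is a smooth vector field, strictly
inward on `∂W`, with `dG(Z) < 0` on `{σ < κ}`: on `{‖f‖ ≤ r₄}` uniformly
(`dG(N) ≤ C`, `dG(ν) = ε bb'(σ) dσ(ν) ≤ -ε μ`), on `{‖f‖ ≥ r₄}` pointwise
(`dG(N) = 2⟪f - c₀, df N⟫ + ε bb'(σ) < 0`, `β₃ dG(ν) ≤ 0`). [cite: Kas1980, §2]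
[cite: GompfStipsiczGSM1999, §8.2] -/
theorem exists_kasField (D : FlowoutInput 3 W) {c₀ : EuclideanSpace ℝ (Fin 2)} {r₄ r₄' r : ℝ}
    (hr₄ : 0 ≤ r₄) (h44 : r₄ < r₄') (h4r : r₄' ≤ r)
    (hvert : ∀ x, r₄ ≤ ‖P.f x‖ →
      ⟪P.f x - c₀, mfderiv (𝓡∂ 4) 𝓘(ℝ, EuclideanSpace ℝ (Fin 2)) P.f x (D.ξ x)⟫ < 0)
    {ν : Π x : W, TangentSpace (𝓡∂ 4) x}
    (hνs : ContMDiff (𝓡∂ 4) (𝓡∂ 4).tangent ∞ (fun x => (⟨x, ν x⟩ : TangentBundle (𝓡∂ 4) W)))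
    (hνw : ∀ z ∈ (𝓡∂ 4).boundary W, 0 ≤ halfSpaceCoord 3 (ν z))
    (hνk : ∀ x, ‖P.f x‖ ≤ r → mfderiv (𝓡∂ 4) 𝓘(ℝ, EuclideanSpace ℝ (Fin 2)) P.f x (ν x) = 0)
    {s₁ : ℝ} (hs₁ν : ∀ x, ‖P.f x‖ ≤ r → D.f x < s₁ → 0 < mlineDeriv (𝓡∂ 4) D.f x (ν x))
    {κ c ε : ℝ} (hκc : κ < c) (hκs : κ < s₁) (hκD : κ ≤ D.δ) (hε : 0 < ε)
    {bb : ℝ → ℝ} (hbb : ContDiff ℝ ∞ bb) (hbb' : ∀ t ∈ Icc 0 κ, deriv bb t < 0)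
    {G : W → ℝ} (hG : ∀ x, D.f x < c → G =ᶠ[𝓝 x] fun y => ‖P.f y - c₀‖ ^ 2 + ε * bb (D.f y)) :
    ∃ Z : Π x : W, TangentSpace (𝓡∂ 4) x,
      ContMDiff (𝓡∂ 4) (𝓡∂ 4).tangent ∞ (fun x => (⟨x, Z x⟩ : TangentBundle (𝓡∂ 4) W)) ∧
      (∀ z ∈ (𝓡∂ 4).boundary W, 0 < halfSpaceCoord 3 (Z z)) ∧
      ∀ x, D.f x < κ → mlineDeriv (𝓡∂ 4) G x (Z x) < 0 := by
  -- the bump of the base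
  set β₃ : ContDiffBump (0 : EuclideanSpace ℝ (Fin 2)) := ⟨(r₄ + r₄') / 2, r₄', by linarith, by linarith⟩
    with hβ₃
  have hβ₃one : ∀ u : EuclideanSpace ℝ (Fin 2), ‖u‖ ≤ r₄ → β₃ u = 1 := fun u hu =>
    β₃.one_of_mem_closedBall (by rw [Metric.mem_closedBall, dist_zero_right]; show ‖u‖ ≤ (r₄ + r₄') / 2; linarith)
  have hβ₃zero : ∀ u : EuclideanSpace ℝ (Fin 2), r₄' ≤ ‖u‖ → β₃ u = 0 := fun u hu =>
    β₃.zero_of_le_dist (by rw [dist_zero_right]; exact hu)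
  -- the near-boundary form and its derivatives along `N` and `ν`
  set G₀ : W → ℝ := fun y => ‖P.f y - c₀‖ ^ 2 + ε * bb (D.f y) with hG₀
  have hTN : ∀ x, D.f x ≤ D.δ → mlineDeriv (𝓡∂ 4) G₀ x (D.ξ x) =
      2 * ⟪P.f x - c₀, mfderiv (𝓡∂ 4) 𝓘(ℝ, EuclideanSpace ℝ (Fin 2)) P.f x (D.ξ x)⟫ +
        ε * deriv bb (D.f x) := by
    intro x hx
    rw [hG₀, P.mlineDeriv_nearForm D.f_smooth hbb c₀ ε x (D.ξ x), D.mlineDeriv_f_ξ x hx, mul_one]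
  have hTν : ∀ x, ‖P.f x‖ ≤ r → mlineDeriv (𝓡∂ 4) G₀ x (ν x) =
      ε * (deriv bb (D.f x) * mlineDeriv (𝓡∂ 4) D.f x (ν x)) := by
    intro x hx
    have h0 : ⟪P.f x - c₀, mfderiv (𝓡∂ 4) 𝓘(ℝ, EuclideanSpace ℝ (Fin 2)) P.f x (ν x)⟫ = 0 :=
      (congrArg _ (hνk x hx)).trans (inner_zero_right _)
    rw [hG₀, P.mlineDeriv_nearForm D.f_smooth hbb c₀ ε x (ν x), h0, mul_zero, zero_add]
  -- uniform constants on the compact `S = {σ ≤ κ, ‖f‖ ≤ r₄'}`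
  set S : Set W := {x | D.f x ≤ κ ∧ ‖P.f x‖ ≤ r₄'} with hS
  have hSc : IsCompact S :=
    ((isClosed_le D.f_smooth.continuous continuous_const).inter
      (isClosed_le (continuous_norm.comp P.contMDiff.continuous) continuous_const)).isCompact
  set φ₁ : W → ℝ := fun x =>
    2 * ⟪P.f x - c₀, mfderiv (𝓡∂ 4) 𝓘(ℝ, EuclideanSpace ℝ (Fin 2)) P.f x (D.ξ x)⟫ with hφ₁
  have hφ₁c : Continuous φ₁ := continuous_const.mul
    ((P.contMDiff.continuous.sub continuous_const).inner (P.continuous_mfderiv_section D.ξ_smooth))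
  obtain ⟨C, hC⟩ : ∃ C : ℝ, ∀ x ∈ S, φ₁ x ≤ C := by
    obtain ⟨C, hC⟩ := hSc.exists_bound_of_continuousOn hφ₁c.continuousOn
    exact ⟨C, fun x hx => (le_abs_self _).trans ((Real.norm_eq_abs _).symm.le.trans (hC x hx))⟩
  set φ₂ : W → ℝ := fun x => -deriv bb (D.f x) * mlineDeriv (𝓡∂ 4) D.f x (ν x) with hφ₂
  have hφ₂c : Continuous φ₂ :=
    ((hbb.continuous_deriv (by simp)).comp D.f_smooth.continuous).neg.mul
      (contMDiff_mlineDeriv_section D.f_smooth hνs).continuous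
  have hφ₂pos : ∀ x ∈ S, 0 < φ₂ x := by
    intro x hx
    have h1 : deriv bb (D.f x) < 0 := hbb' _ ⟨D.f_nonneg x, hx.1⟩
    have h2 : 0 < mlineDeriv (𝓡∂ 4) D.f x (ν x) := hs₁ν x (hx.2.trans h4r) (lt_of_le_of_lt hx.1 hκs)
    show 0 < -deriv bb (D.f x) * mlineDeriv (𝓡∂ 4) D.f x (ν x)
    nlinarith
  obtain ⟨μ, hμ, hμle⟩ : ∃ μ : ℝ, 0 < μ ∧ ∀ x ∈ S, μ ≤ φ₂ x := by
    by_cases hne : S.Nonempty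
    · obtain ⟨x₀, hx₀, hmin⟩ := hSc.exists_isMinOn hne hφ₂c.continuousOn
      exact ⟨φ₂ x₀, hφ₂pos x₀ hx₀, fun x hx => isMinOn_iff.1 hmin x hx⟩
    · exact ⟨1, one_pos, fun x hx => absurd ⟨x, hx⟩ hne⟩
  set M : ℝ := max C 0 / (ε * μ) + 1 with hM
  have hM0 : 0 < M := by positivity
  have hMkey : C < M * (ε * μ) := by
    rw [hM, add_mul, div_mul_cancel₀ _ (by positivity), one_mul]
    linarith [le_max_left C 0, mul_pos hε hμ]
  -- the field
  set Z : Π x : W, TangentSpace (𝓡∂ 4) x := fun x => D.ξ x + (M * β₃ (P.f x)) • ν x with hZ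
  have hcoef : ContMDiff (𝓡∂ 4) 𝓘(ℝ, ℝ) ∞ fun x => M * β₃ (P.f x) :=
    contMDiff_const.mul (β₃.contDiff.comp_contMDiff P.contMDiff)
  refine ⟨Z, D.ξ_smooth.add_section (hcoef.smul_section hνs), fun z hz => ?_, fun x hx => ?_⟩
  · -- strictly inward at the boundary
    have e1 := (halfSpaceCoord 3).map_add (D.ξ z) ((M * β₃ (P.f z)) • ν z)
    have e2 := (halfSpaceCoord 3).map_smul (M * β₃ (P.f z)) (ν z)
    have e : halfSpaceCoord 3 (Z z) = halfSpaceCoord 3 (D.ξ z) + (M * β₃ (P.f z)) • halfSpaceCoord 3 (ν z) :=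
      e1.trans (congrArg (fun t => halfSpaceCoord 3 (D.ξ z) + t) e2)
    rw [e, smul_eq_mul]
    have h1 := halfSpaceCoord_flowout_ξ_pos D hz
    have h2 : 0 ≤ M * β₃ (P.f z) * halfSpaceCoord 3 (ν z) :=
      mul_nonneg (mul_nonneg hM0.le (β₃.nonneg)) (hνw z hz)
    linarith
  · -- `dG(Z) < 0` below the level `κ`
    have hev := hG x (hx.trans hκc)
    have hGG₀ : mlineDeriv (𝓡∂ 4) G x (Z x) = mlineDeriv (𝓡∂ 4) G₀ x (Z x) := by
      simp only [mlineDeriv_def]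
      exact DFunLike.congr_fun hev.mfderiv_eq (Z x)
    rw [hGG₀]
    have hsplit : mlineDeriv (𝓡∂ 4) G₀ x (Z x) =
        mlineDeriv (𝓡∂ 4) G₀ x (D.ξ x) + (M * β₃ (P.f x)) * mlineDeriv (𝓡∂ 4) G₀ x (ν x) := by
      simp only [hZ]
      rw [mlineDeriv_add, mlineDeriv_smul]
    rw [hsplit, hTN x (hx.le.trans hκD)]
    have hbx : deriv bb (D.f x) < 0 := hbb' _ ⟨D.f_nonneg x, hx.le⟩
    rcases le_or_gt ‖P.f x‖ r₄ with hfx | hfx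
    · -- the uniform zone `‖f x‖ ≤ r₄`
      have hxS : x ∈ S := ⟨hx.le, hfx.trans h44.le⟩
      rw [hβ₃one _ hfx, mul_one, hTν x ((hfx.trans h44.le).trans h4r)]
      have h1 : φ₁ x ≤ C := hC x hxS
      have h2 : μ ≤ φ₂ x := hμle x hxS
      have h3 : ε * deriv bb (D.f x) < 0 := mul_neg_of_pos_of_neg hε hbx
      have h4 : M * (ε * (deriv bb (D.f x) * mlineDeriv (𝓡∂ 4) D.f x (ν x))) = -(M * (ε * φ₂ x)) := by
        simp only [hφ₂]; ring
      rw [h4]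
      have h5 : M * (ε * μ) ≤ M * (ε * φ₂ x) :=
        mul_le_mul_of_nonneg_left (mul_le_mul_of_nonneg_left h2 hε.le) hM0.le
      have h6 : φ₁ x = 2 * ⟪P.f x - c₀, mfderiv (𝓡∂ 4) 𝓘(ℝ, EuclideanSpace ℝ (Fin 2)) P.f x (D.ξ x)⟫ := rfl
      linarith
    · -- the vertical zone `‖f x‖ > r₄`
      have h1 := hvert x hfx.le
      have h3 : ε * deriv bb (D.f x) < 0 := mul_neg_of_pos_of_neg hε hbx
      have h4 : M * β₃ (P.f x) * mlineDeriv (𝓡∂ 4) G₀ x (ν x) ≤ 0 := by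
        rcases lt_or_ge ‖P.f x‖ r₄' with hfx' | hfx'
        · rw [hTν x (hfx'.le.trans h4r)]
          have h5 : 0 < mlineDeriv (𝓡∂ 4) D.f x (ν x) := hs₁ν x (hfx'.le.trans h4r) (hx.trans hκs)
          have h6 : ε * (deriv bb (D.f x) * mlineDeriv (𝓡∂ 4) D.f x (ν x)) ≤ 0 := by nlinarith
          exact mul_nonpos_of_nonneg_of_nonpos (mul_nonneg hM0.le β₃.nonneg) h6
        · rw [hβ₃zero _ hfx', mul_zero, zero_mul]
      linarith

end PALF

end Literature.Geometry.Symplectic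

end
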